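import Literature.Topology.FourManifolds.CapGermAlignment
import Literature.Topology.FourManifolds.ThickAlignment
import HarnessLib

/-!
# Aligned ball parametrisations: a ball coinciding with a model ball along a cap is
# parametrised so as to agree with the model parametrisation on a thick zone

Topic `Literature/Topology/FourManifolds`; fact seat of Alexander's theorem
(`provefact-Literature.Topology.FourManifolds.SphereEmbedding.schoenflies_exists_ball`, Schultens
(2014), Thm. 3.2.5).  **Everything in this file is proved; no definitions, no named facts.**

In the inductive step of the printed proof (Schultens (2014), PDF p. 45) a ball `B` bounded by one
of the two smoothed spheres `D ∪ Dᵢ` is pushed across (Lemma 3.2.3, PDF pp. 42–43: "a collar of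
`c ∪ D₁ ∪ D₂` … homeomorphic to a standard object").  The fact seat realises the push by a sweep
guided by a function transported along a parametrisation `Ψ : 𝔻̄ ≅ B` of the ball; for the new
boundary to be explicit the parametrisation must *coincide with the explicit model
parametrisation `Φ_M` of the model solid `M ⊆ B`* (which agrees with `B` along the cap of
directions `⟪u, ·⟫ > 0`) on the whole zone `{⟪u, y⟫ ≥ m}` of the closed unit ball, `m > 0`
arbitrary.  This file assembles that parametrisation from the landed tools:

* `AlignAssembly.exists_alignedParam` — given diffeomorphisms `Φ_B`, `Φ_M` of `ℝⁿ⁺¹` with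
  `Φ_M(𝔻̄) ⊆ Φ_B(𝔻̄)` and `Φ_M(y) ∈ Φ_B(𝕊ⁿ)` for unit `y` with `⟪u, y⟫ > 0`, and `0 < m < 1`,
  there are `δ' > 0` and a smooth embedding `Ψ` of the ball `‖y‖ < 1 + δ'` (with smooth inverse
  on its open image) with `Ψ(𝔻̄) = Φ_B(𝔻̄)`, `Ψ(𝕊ⁿ) = Φ_B(𝕊ⁿ)`, `Ψ(𝔹) = Φ_B(𝔹)` and
  **`Ψ y = Φ_M y` whenever `‖y‖ < 1 + δ'` and `⟪u, y⟫ ≥ m`**.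

Proof: `ι = Φ_B⁻¹ ∘ Φ_M` preserves the sphere and the open ball along the open cap
`{⟪u, ·⟫ > 0}`; the cap germ alignment (`CapGermAlignment.exists_alignment`) gives a local
diffeomorphism `Λ` near `𝔻̄`, preserving `𝔹`, equal to `ι` on the two-sided shell over the cone
`⟪u, x⟫ ≥ (m/2)‖x‖`; `j = Λ⁻¹ ∘ ι` is then alignment data for the thick alignment
(`ThickAlignment.AlignData.exists_diffeomorph`: the dilation isotopy conjugated by the inversion
`ψ`, integrated by a compactly supported flow) with the lens `‖ψ x‖ ≤ r`, `r² = (1-m)/(1+m)`,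
which contains the zone; the resulting `χ` (`= j` on the lens, `= id` off `𝔹`) gives
`Ψ = Φ_B ∘ Λ ∘ χ`.

## References
* J. Schultens, *Introduction to 3-Manifolds*, GSM 151, AMS (2014), Lemma 3.2.3, Thm. 3.2.5
  (PDF pp. 42–45).
* M. W. Hirsch, *Differential Topology*, GTM 33 (1976), Ch. 8 (isotopy, disc theorem).
-/

noncomputable section

open Set Metric Filter Topology Function
open scoped ContDiff RealInnerProductSpace Manifold

namespace Literature.Topology.FourManifolds.AlignAssembly

variable {n : ℕ}

/-! ### §1 Small tools on diffeomorphisms of a normed space -/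

section Tools

variable {F : Type*} [NormedAddCommGroup F] [NormedSpace ℝ F]

/-- Membership in the image of a set under a diffeomorphism. [folklore] -/
theorem mem_image_iff (Φ : F ≃ₘ⟮𝓘(ℝ, F), 𝓘(ℝ, F)⟯ F) (s : Set F) (z : F) :
    z ∈ Φ '' s ↔ Φ.symm z ∈ s := by
  constructor
  · rintro ⟨x, hx, rfl⟩
    rwa [Φ.symm_apply_apply]
  · intro h
    exact ⟨_, h, Φ.apply_symm_apply z⟩

-- (A diffeomorphism of a normed space is `C^∞` as a map: this is Mathlib's
-- `Diffeomorph.contDiff`, used directly below.)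

/-- A diffeomorphism maps interiors to interiors. [folklore] -/
theorem image_interior_diffeo (Φ : F ≃ₘ⟮𝓘(ℝ, F), 𝓘(ℝ, F)⟯ F) (s : Set F) :
    Φ '' interior s = interior (Φ '' s) := by
  have := Φ.toHomeomorph.image_interior s
  simpa using this

/-- A diffeomorphism maps open sets to open sets. [folklore] -/
theorem isOpen_image_diffeo (Φ : F ≃ₘ⟮𝓘(ℝ, F), 𝓘(ℝ, F)⟯ F) {s : Set F} (hs : IsOpen s) :
    IsOpen (Φ '' s) := by
  have := (Φ.toHomeomorph.isOpen_image (s := s)).2 hs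
  simpa using this

omit [NormedSpace ℝ F] in
/-- **Images of open subsets under a local homeomorphism given by an inverse pair**: if `Λ` is
continuous on the open set `O` with continuous inverse `Λinv` on the open image `Λ(O)`, then
`Λ(V)` is open for every open `V ⊆ O`. [folklore] -/
theorem isOpen_image_of_inverse {Λ Λinv : F → F} {O : Set F} (hΛO : IsOpen (Λ '' O))
    (hΛinv : ContinuousOn Λinv (Λ '' O)) (hleft : ∀ x ∈ O, Λinv (Λ x) = x)
    {V : Set F} (hV : IsOpen V) (hVO : V ⊆ O) : IsOpen (Λ '' V) := by
  have heq : Λ '' V = Λ '' O ∩ Λinv ⁻¹' V := by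
    ext z
    constructor
    · rintro ⟨v, hv, rfl⟩
      exact ⟨⟨v, hVO hv, rfl⟩, by rw [mem_preimage, hleft v (hVO hv)]; exact hv⟩
    · rintro ⟨⟨y, hy, rfl⟩, hz⟩
      rw [mem_preimage, hleft y hy] at hz
      exact ⟨y, hz, rfl⟩
  rw [heq]
  exact hΛinv.isOpen_inter_preimage hΛO hV

omit [NormedSpace ℝ F] in
/-- `|‖x‖ - 1| ≤ |‖x‖² - 1|`. [folklore] -/
theorem abs_norm_sub_one_le (x : F) : |‖x‖ - 1| ≤ |‖x‖ ^ 2 - 1| := by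
  have h : ‖x‖ ^ 2 - 1 = (‖x‖ - 1) * (‖x‖ + 1) := by ring
  rw [h, abs_mul]
  have h1 : 1 ≤ |‖x‖ + 1| := by
    rw [abs_of_nonneg (by positivity)]; linarith [norm_nonneg x]
  nlinarith [abs_nonneg (‖x‖ - 1)]

end Tools

/-! ### §2 The aligned parametrisation -/

/-- **Aligned ball parametrisation.**  Let `Φ_B`, `Φ_M` be diffeomorphisms of `ℝⁿ⁺¹`
(`n ≠ 0`) with `Φ_M(𝔻̄) ⊆ Φ_B(𝔻̄)` and `Φ_M(y) ∈ Φ_B(𝕊ⁿ)` for all unit `y` with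
`⟪u, y⟫ > 0` (the model ball lies in the ball and their boundaries agree along the open cap
about `u`), and let `0 < m < 1`.  Then there are `δ' ∈ (0, 1]` and a smooth embedding `Ψ` of the
ball `‖y‖ < 1 + δ'`, with open image and smooth inverse `Ψinv` there, such that
`Ψ(𝔻̄) = Φ_B(𝔻̄)`, `Ψ(𝕊ⁿ) = Φ_B(𝕊ⁿ)`, `Ψ(𝔹) = Φ_B(𝔹)`, and `Ψ y = Φ_M y` whenever
`‖y‖ < 1 + δ'` and `⟪u, y⟫ ≥ m`. [cite: Schultens2014, Lemma 3.2.3 and Thm. 3.2.5 (PDF pp. 42–45)] -/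
theorem exists_alignedParam (hn : n ≠ 0) (u : sphere (0 : EuclideanSpace ℝ (Fin (n + 1))) 1)
    (ΦB ΦM : EuclideanSpace ℝ (Fin (n + 1)) ≃ₘ⟮𝓘(ℝ, EuclideanSpace ℝ (Fin (n + 1))),
      𝓘(ℝ, EuclideanSpace ℝ (Fin (n + 1)))⟯ EuclideanSpace ℝ (Fin (n + 1)))
    {m : ℝ} (hm0 : 0 < m) (hm1 : m < 1)
    (hsub : ΦM '' closedBall 0 1 ⊆ ΦB '' closedBall 0 1)
    (hsph : ∀ y : EuclideanSpace ℝ (Fin (n + 1)), ‖y‖ = 1 →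
      0 < ⟪(u : EuclideanSpace ℝ (Fin (n + 1))), y⟫ → ΦM y ∈ ΦB '' sphere 0 1) :
    ∃ (Ψ Ψinv : EuclideanSpace ℝ (Fin (n + 1)) → EuclideanSpace ℝ (Fin (n + 1))) (δ' : ℝ),
      0 < δ' ∧ δ' ≤ 1 ∧
      ContDiffOn ℝ ∞ Ψ (ball 0 (1 + δ')) ∧ InjOn Ψ (ball 0 (1 + δ')) ∧
      IsOpen (Ψ '' ball 0 (1 + δ')) ∧ ContDiffOn ℝ ∞ Ψinv (Ψ '' ball 0 (1 + δ')) ∧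
      (∀ y ∈ ball (0 : EuclideanSpace ℝ (Fin (n + 1))) (1 + δ'), Ψinv (Ψ y) = y) ∧
      (∀ z ∈ Ψ '' ball (0 : EuclideanSpace ℝ (Fin (n + 1))) (1 + δ'), Ψ (Ψinv z) = z) ∧
      Ψ '' closedBall 0 1 = ΦB '' closedBall 0 1 ∧ Ψ '' sphere 0 1 = ΦB '' sphere 0 1 ∧
      Ψ '' ball 0 1 = ΦB '' ball 0 1 ∧
      (∀ y : EuclideanSpace ℝ (Fin (n + 1)), ‖y‖ < 1 + δ' →
        m ≤ ⟪(u : EuclideanSpace ℝ (Fin (n + 1))), y⟫ → Ψ y = ΦM y) := by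
  have hu1 : ‖(u : EuclideanSpace ℝ (Fin (n + 1)))‖ = 1 := mem_sphere_zero_iff_norm.1 u.2
  -- the comparison map `ι = Φ_B⁻¹ ∘ Φ_M`
  set ι : EuclideanSpace ℝ (Fin (n + 1)) ≃ₘ⟮𝓘(ℝ, EuclideanSpace ℝ (Fin (n + 1))),
      𝓘(ℝ, EuclideanSpace ℝ (Fin (n + 1)))⟯ EuclideanSpace ℝ (Fin (n + 1)) := ΦM.trans ΦB.symm with hιdef
  have hιapp : ∀ y, ι y = ΦB.symm (ΦM y) := fun y => rfl
  have hιs : ContDiff ℝ ∞ ι := ι.contDiff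
  have hιD : ∀ y : EuclideanSpace ℝ (Fin (n + 1)), ‖y‖ ≤ 1 → ‖ι y‖ ≤ 1 := fun y hy => by
    have : ΦM y ∈ ΦB '' closedBall 0 1 := hsub ⟨y, mem_closedBall_zero_iff.2 hy, rfl⟩
    rw [mem_image_iff] at this
    rw [hιapp]; exact mem_closedBall_zero_iff.1 this
  have hιS : ∀ y : EuclideanSpace ℝ (Fin (n + 1)), ‖y‖ = 1 →
      0 < ⟪(u : EuclideanSpace ℝ (Fin (n + 1))), y⟫ → ‖ι y‖ = 1 := fun y hy hpos => by
    have := hsph y hy hpos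
    rw [mem_image_iff] at this
    rw [hιapp]; exact mem_sphere_zero_iff_norm.1 this
  have hιimgD : ι '' closedBall 0 1 ⊆ closedBall 0 1 := by
    rintro _ ⟨y, hy, rfl⟩
    exact mem_closedBall_zero_iff.2 (hιD y (mem_closedBall_zero_iff.1 hy))
  have hιB : ∀ y : EuclideanSpace ℝ (Fin (n + 1)), ‖y‖ < 1 → ‖ι y‖ < 1 := fun y hy => by
    have h1 : ι '' ball 0 1 ⊆ ball 0 1 := by
      rw [← _root_.interior_closedBall (0 : EuclideanSpace ℝ (Fin (n + 1))) one_ne_zero,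
        image_interior_diffeo]
      exact interior_mono hιimgD
    exact mem_ball_zero_iff.1 (h1 ⟨y, mem_ball_zero_iff.2 hy, rfl⟩)
  -- the cap germ alignment
  have hW₁o : IsOpen {x : EuclideanSpace ℝ (Fin (n + 1)) | 0 < ⟪(u : EuclideanSpace ℝ (Fin (n + 1))), x⟫} :=
    isOpen_lt continuous_const (continuous_const.inner continuous_id)
  obtain ⟨Λ, Λinv, O, δal, hOo, hδal, hDO, hshellO, hΛs, hΛinj, hΛOo, hDΛO, hΛinvs, hΛleft,
      hΛball, hΛsph, hΛι⟩ :=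
    CapGermAlignment.exists_alignment hn u (c₁ := m / 16) (c₀ := m / 8) (cK := m / 4) (cK' := m / 2)
      (by linarith) (by linarith) (by linarith) (by linarith) (by linarith) ι hW₁o
      (fun x hx hx1 => hιS x hx1 hx) (fun x _ hx1 => hιB x hx1)
      (fun x _ hc => lt_trans (by positivity) hc)
  have hright : ∀ z ∈ Λ '' O, Λ (Λinv z) = z := by
    rintro _ ⟨y, hy, rfl⟩; rw [hΛleft y hy]
  have hBO : ball (0 : EuclideanSpace ℝ (Fin (n + 1))) 1 ⊆ O := ball_subset_closedBall.trans hDO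
  -- `Λ(𝕊) = 𝕊`, `Λ(𝔻̄) = 𝔻̄`
  have hΛsphere : Λ '' sphere 0 1 = sphere 0 1 := by
    apply Subset.antisymm
    · rintro _ ⟨x, hx, rfl⟩
      exact mem_sphere_zero_iff_norm.2 (hΛsph x (mem_sphere_zero_iff_norm.1 hx))
    · intro y hy
      obtain ⟨x, hxO, rfl⟩ := hDΛO (sphere_subset_closedBall hy)
      have hy1 : ‖Λ x‖ = 1 := mem_sphere_zero_iff_norm.1 hy
      rcases lt_trichotomy ‖x‖ 1 with hlt | heq | hgt
      · exfalso
        have : Λ x ∈ Λ '' ball 0 1 := ⟨x, mem_ball_zero_iff.2 hlt, rfl⟩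
        rw [hΛball] at this
        have := mem_ball_zero_iff.1 this
        linarith
      · exact ⟨x, mem_sphere_zero_iff_norm.2 heq, rfl⟩
      · exfalso
        -- `Λinv` is continuous at `Λ x` with value `x` of norm `> 1`; nearby points of `𝔹` contradict
        have hz : Λ x ∈ Λ '' O := ⟨x, hxO, rfl⟩
        have hcont : ContinuousAt Λinv (Λ x) := (hΛinvs.continuousOn.continuousWithinAt hz).continuousAt
          (hΛOo.mem_nhds hz)
        have hev : ∀ᶠ z in 𝓝 (Λ x), 1 < ‖Λinv z‖ := by
          have : ∀ᶠ z in 𝓝 (Λ x), Λinv z ∈ {w : EuclideanSpace ℝ (Fin (n + 1)) | 1 < ‖w‖} :=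
            hcont.preimage_mem_nhds ((isOpen_lt continuous_const continuous_norm).mem_nhds
              (by rw [mem_setOf_eq, hΛleft x hxO]; exact hgt))
          exact this
        have hfr : Λ x ∈ frontier (ball (0 : EuclideanSpace ℝ (Fin (n + 1))) 1) := by
          rw [_root_.frontier_ball (0 : EuclideanSpace ℝ (Fin (n + 1))) one_ne_zero]; exact hy
        rw [frontier_eq_closure_inter_closure] at hfr
        have hcl := hfr.1
        rw [mem_closure_iff_nhds] at hcl
        obtain ⟨z, hz1, hzB⟩ := hcl _ hev
        have hzB' : z ∈ Λ '' ball 0 1 := by rw [hΛball]; exact hzB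
        obtain ⟨w, hw, rfl⟩ := hzB'
        have : 1 < ‖Λinv (Λ w)‖ := hz1
        rw [hΛleft w (hBO hw)] at this
        linarith [mem_ball_zero_iff.1 hw]
  have hΛclosedBall : Λ '' closedBall 0 1 = closedBall 0 1 := by
    rw [← ball_union_sphere, image_union, hΛball, hΛsphere]
  -- the constants of the thick alignment
  set r : ℝ := Real.sqrt ((1 - m) / (1 + m)) with hr
  set r' : ℝ := Real.sqrt ((1 - m / 2) / (1 + m / 2)) with hr'
  set δ : ℝ := min (1 / 16) (δal / 8) with hδ
  have hqr : 0 < (1 - m) / (1 + m) := div_pos (by linarith) (by linarith)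
  have hqr' : 0 < (1 - m / 2) / (1 + m / 2) := div_pos (by linarith) (by linarith)
  have hr0 : 0 < r := Real.sqrt_pos.2 hqr
  have hr'0 : 0 < r' := Real.sqrt_pos.2 hqr'
  have hrsq : r ^ 2 = (1 - m) / (1 + m) := Real.sq_sqrt hqr.le
  have hr'sq : r' ^ 2 = (1 - m / 2) / (1 + m / 2) := Real.sq_sqrt hqr'.le
  have hrr' : r < r' := by
    rw [hr, hr']
    apply Real.sqrt_lt_sqrt hqr.le
    rw [div_lt_div_iff₀ (by linarith) (by linarith)]
    nlinarith
  have hr'1 : r' < 1 := by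
    rw [hr', Real.sqrt_lt' one_pos, one_pow, div_lt_one (by linarith)]
    linarith
  have hcone : (1 - r' ^ 2) / (1 + r' ^ 2) = m / 2 := by
    rw [hr'sq]
    have h1 : (1 + m / 2 : ℝ) ≠ 0 := by linarith
    field_simp
    ring
  have hδ0 : 0 < δ := lt_min (by norm_num) (by linarith)
  have hδ1 : δ ≤ 1 / 16 := min_le_left _ _
  have hδal8 : 8 * δ ≤ δal := by
    have := min_le_right (1 / 16 : ℝ) (δal / 8); rw [← hδ] at this; linarith
  -- direction cosine on the big lens
  have hcos : ∀ x : EuclideanSpace ℝ (Fin (n + 1)), x ≠ -(u : EuclideanSpace ℝ (Fin (n + 1))) →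
      ‖ThickAlignment.inv (u : EuclideanSpace ℝ (Fin (n + 1))) x‖ < r' → x ≠ 0 →
      m / 2 ≤ ⟪(u : EuclideanSpace ℝ (Fin (n + 1))), x⟫ / ‖x‖ := fun x hxu hxr hx0 => by
    have h1 := ThickAlignment.inner_ge_mul_norm_of_norm_inv_le hu1 hxu hr'0.le hr'1 hxr.le
    rw [hcone, real_inner_comm] at h1
    rw [le_div_iff₀ (norm_pos_iff.2 hx0)]
    exact h1
  -- shell points are in `O`
  have hshell : ∀ x : EuclideanSpace ℝ (Fin (n + 1)), |‖x‖ ^ 2 - 1| < 8 * δ → x ∈ O ∧ 1 - δal < ‖x‖ ∧ x ≠ 0 :=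
      fun x hx => by
    have h1 : |‖x‖ - 1| < δal := lt_of_le_of_lt (abs_norm_sub_one_le x) (by linarith)
    refine ⟨hshellO x h1, by linarith [(abs_lt.1 h1).1], ?_⟩
    intro h0
    rw [h0, norm_zero] at hx
    have := (abs_lt.1 hx).1
    linarith
  -- points of the big lens are not the pole `-u`
  have hne_of_lt : ∀ x : EuclideanSpace ℝ (Fin (n + 1)),
      ‖ThickAlignment.inv (u : EuclideanSpace ℝ (Fin (n + 1))) x‖ < r' →
      x ≠ -(u : EuclideanSpace ℝ (Fin (n + 1))) := fun x hxr h => by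
    have : ThickAlignment.inv (u : EuclideanSpace ℝ (Fin (n + 1))) x = -(u : EuclideanSpace ℝ (Fin (n + 1))) := by
      rw [h]; simp [ThickAlignment.inv]
    rw [this, norm_neg, hu1] at hxr
    linarith
  -- the alignment data `j = Λ⁻¹ ∘ ι`
  set Oj : Set (EuclideanSpace ℝ (Fin (n + 1))) := {x | ι x ∈ Λ '' O ∧ ‖x‖ ^ 2 < 1 + 8 * δ} with hOj
  set j : EuclideanSpace ℝ (Fin (n + 1)) → EuclideanSpace ℝ (Fin (n + 1)) := fun x => Λinv (ι x) with hj
  set jinv : EuclideanSpace ℝ (Fin (n + 1)) → EuclideanSpace ℝ (Fin (n + 1)) := fun y => ι.symm (Λ y)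
    with hjinv
  have hOjo : IsOpen Oj := by
    have h1 : IsOpen (ι ⁻¹' (Λ '' O)) := hΛOo.preimage hιs.continuous
    have h2 : IsOpen {x : EuclideanSpace ℝ (Fin (n + 1)) | ‖x‖ ^ 2 < 1 + 8 * δ} :=
      isOpen_lt (continuous_norm.pow 2) continuous_const
    exact h1.inter h2
  have hjOj : j '' Oj = O ∩ Λ ⁻¹' (ι '' Oj) := by
    ext y
    constructor
    · rintro ⟨x, hx, rfl⟩
      obtain ⟨y₀, hy₀, hy₀e⟩ := hx.1
      have hjx : j x = y₀ := by simp only [hj]; rw [← hy₀e, hΛleft y₀ hy₀]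
      refine ⟨by rw [hjx]; exact hy₀, ?_⟩
      rw [mem_preimage, hjx, hy₀e]
      exact ⟨x, hx, rfl⟩
    · rintro ⟨hyO, ⟨x, hx, hxe⟩⟩
      refine ⟨x, hx, ?_⟩
      simp only [hj]; rw [hxe, hΛleft y hyO]
  have hjOjO : j '' Oj ⊆ O := by rw [hjOj]; exact inter_subset_left
  have hAD : ThickAlignment.AlignData (u : EuclideanSpace ℝ (Fin (n + 1))) j jinv Oj r r' δ :=
    { hu := hu1
      hr := hr0
      hrr' := hrr'
      hr'1 := hr'1
      hδ := hδ0
      hδ1 := hδ1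
      hOj := hOjo
      hΩ := by
        rintro x ⟨hxu, hxr, hx2⟩
        refine ⟨?_, hx2⟩
        by_cases h1 : ‖x‖ ≤ 1
        · exact hDΛO (mem_closedBall_zero_iff.2 (hιD x h1))
        · push Not at h1
          have habs : |‖x‖ ^ 2 - 1| < 8 * δ := by
            rw [abs_of_nonneg (by nlinarith)]; linarith
          obtain ⟨hxO, hxal, hx0⟩ := hshell x habs
          have := hΛι x hxO hxal hx0 (hcos x hxu hxr hx0)
          rw [← this]
          exact ⟨x, hxO, rfl⟩
      hj := by
        refine hΛinvs.comp hιs.contDiffOn ?_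
        intro x hx; exact hx.1
      hjo := by
        rw [hjOj]
        exact hΛs.continuousOn.isOpen_inter_preimage hOo (isOpen_image_diffeo ι hOjo)
      hjinv := by
        exact ι.symm.contDiff.comp_contDiffOn (hΛs.mono hjOjO)
      hleft := by
        intro x hx
        simp only [hj, hjinv]
        rw [hright _ hx.1, ι.symm_apply_apply]
      hid := by
        intro x hx hxr hx1
        have habs : |‖x‖ ^ 2 - 1| < 8 * δ := abs_lt.2 ⟨by linarith, by linarith [hx.2]⟩
        obtain ⟨hxO, hxal, hx0⟩ := hshell x habs
        have hxu : x ≠ -(u : EuclideanSpace ℝ (Fin (n + 1))) := hne_of_lt x hxr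
        have := hΛι x hxO hxal hx0 (hcos x hxu hxr hx0)
        simp only [hj]
        rw [← this, hΛleft x hxO]
      hball := by
        intro x hx hx1
        obtain ⟨y₀, hy₀, hy₀e⟩ := hx.1
        have hjx : j x = y₀ := by simp only [hj]; rw [← hy₀e, hΛleft y₀ hy₀]
        rw [hjx]
        by_contra hge
        push Not at hge
        have hιx : ι x ∈ Λ '' ball 0 1 := by rw [hΛball]; exact mem_ball_zero_iff.2 (hιB x hx1)
        obtain ⟨y₁, hy₁, hy₁e⟩ := hιx
        have : y₁ = y₀ := hΛinj (hBO hy₁) hy₀ (by rw [hy₁e, hy₀e])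
        rw [← this] at hge
        linarith [mem_ball_zero_iff.1 hy₁] }
  -- the thick alignment
  obtain ⟨χ, hχ1, hχ2, hχ3, hχ4⟩ := hAD.exists_diffeomorph
  have hχs : ContDiff ℝ ∞ χ := χ.contDiff
  have hχsphere : χ '' sphere 0 1 = sphere 0 1 := by
    have : ∀ x ∈ sphere (0 : EuclideanSpace ℝ (Fin (n + 1))) 1, χ x = x := fun x hx =>
      hχ1 x (le_of_eq (mem_sphere_zero_iff_norm.1 hx).symm)
    rw [image_congr this, image_id']
  have hχclosedBall : χ '' closedBall 0 1 = closedBall 0 1 := by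
    rw [← ball_union_sphere, image_union, hχ4, hχsphere]
  -- the parametrisation
  set δ' : ℝ := min δal 1 with hδ'
  have hδ'0 : 0 < δ' := lt_min hδal one_pos
  have hδ'al : δ' ≤ δal := min_le_left _ _
  have hδ'1 : δ' ≤ 1 := min_le_right _ _
  set Ψ : EuclideanSpace ℝ (Fin (n + 1)) → EuclideanSpace ℝ (Fin (n + 1)) := fun y => ΦB (Λ (χ y)) with hΨ
  set Ψinv : EuclideanSpace ℝ (Fin (n + 1)) → EuclideanSpace ℝ (Fin (n + 1)) :=
    fun z => χ.symm (Λinv (ΦB.symm z)) with hΨinv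
  -- the domain maps into `O` under `χ`
  have hχO : ∀ y : EuclideanSpace ℝ (Fin (n + 1)), ‖y‖ < 1 + δ' → χ y ∈ O := fun y hy => by
    by_cases h1 : ‖y‖ < 1
    · have : χ y ∈ χ '' ball 0 1 := ⟨y, mem_ball_zero_iff.2 h1, rfl⟩
      rw [hχ4] at this
      exact hBO this
    · push Not at h1
      rw [hχ1 y h1]
      exact hshellO y (by rw [abs_of_nonneg (by linarith)]; linarith)
  have hmaps : MapsTo χ (ball (0 : EuclideanSpace ℝ (Fin (n + 1))) (1 + δ')) O := fun y hy =>
    hχO y (mem_ball_zero_iff.1 hy)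
  have hΨs : ContDiffOn ℝ ∞ Ψ (ball 0 (1 + δ')) := by
    have h1 : ContDiffOn ℝ ∞ (fun y => Λ (χ y)) (ball 0 (1 + δ')) := hΛs.comp hχs.contDiffOn hmaps
    exact ΦB.contDiff.comp_contDiffOn h1
  have hΨinj : InjOn Ψ (ball 0 (1 + δ')) := by
    intro y hy y' hy' heq
    have h1 : Λ (χ y) = Λ (χ y') := ΦB.injective heq
    exact χ.injective (hΛinj (hmaps hy) (hmaps hy') h1)
  have hΨleft : ∀ y ∈ ball (0 : EuclideanSpace ℝ (Fin (n + 1))) (1 + δ'), Ψinv (Ψ y) = y := fun y hy => by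
    simp only [hΨ, hΨinv]
    rw [ΦB.symm_apply_apply, hΛleft _ (hmaps hy), χ.symm_apply_apply]
  have hΨright : ∀ z ∈ Ψ '' ball (0 : EuclideanSpace ℝ (Fin (n + 1))) (1 + δ'), Ψ (Ψinv z) = z := by
    rintro _ ⟨y, hy, rfl⟩; rw [hΨleft y hy]
  have hΨimg : Ψ '' ball 0 (1 + δ') = ΦB '' (Λ '' (χ '' ball 0 (1 + δ'))) := by
    simp only [hΨ, image_image]
  have hΨopen : IsOpen (Ψ '' ball 0 (1 + δ')) := by
    rw [hΨimg]
    refine isOpen_image_diffeo ΦB (isOpen_image_of_inverse hΛOo hΛinvs.continuousOn hΛleft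
      (isOpen_image_diffeo χ isOpen_ball) ?_)
    rintro _ ⟨y, hy, rfl⟩; exact hmaps hy
  have hΨinvs : ContDiffOn ℝ ∞ Ψinv (Ψ '' ball 0 (1 + δ')) := by
    have hsub1 : Ψ '' ball 0 (1 + δ') ⊆ ΦB '' (Λ '' O) := by
      rw [hΨimg]
      exact image_mono (image_mono fun _ ⟨y, hy, e⟩ => e ▸ hmaps hy)
    have h1 : ContDiffOn ℝ ∞ (fun z => Λinv (ΦB.symm z)) (Ψ '' ball 0 (1 + δ')) := by
      refine hΛinvs.comp ΦB.symm.contDiff.contDiffOn ?_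
      intro z hz
      obtain ⟨w, hw, rfl⟩ := hsub1 hz
      show ΦB.symm (ΦB w) ∈ Λ '' O
      rw [ΦB.symm_apply_apply]; exact hw
    exact χ.symm.contDiff.comp_contDiffOn h1
  have hΨball : Ψ '' ball 0 1 = ΦB '' ball 0 1 := by
    simp only [hΨ]; rw [← image_image (g := fun z => ΦB (Λ z)), hχ4, ← image_image, hΛball]
  have hΨsphere : Ψ '' sphere 0 1 = ΦB '' sphere 0 1 := by
    simp only [hΨ]; rw [← image_image (g := fun z => ΦB (Λ z)), hχsphere, ← image_image, hΛsphere]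
  have hΨclosedBall : Ψ '' closedBall 0 1 = ΦB '' closedBall 0 1 := by
    simp only [hΨ]; rw [← image_image (g := fun z => ΦB (Λ z)), hχclosedBall, ← image_image, hΛclosedBall]
  -- agreement with `Φ_M` on the zone
  have hagree : ∀ y : EuclideanSpace ℝ (Fin (n + 1)), ‖y‖ < 1 + δ' →
      m ≤ ⟪(u : EuclideanSpace ℝ (Fin (n + 1))), y⟫ → Ψ y = ΦM y := fun y hy hym => by
    have hy0 : y ≠ 0 := by
      intro h; rw [h, inner_zero_right] at hym; linarith
    have hyu : y ≠ -(u : EuclideanSpace ℝ (Fin (n + 1))) := by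
      intro h
      rw [h, inner_neg_right, real_inner_self_eq_norm_sq, hu1] at hym
      linarith
    have hιy : ΦB (ι y) = ΦM y := by rw [hιapp, ΦB.apply_symm_apply]
    by_cases h1 : ‖y‖ ≤ 1
    · -- inside: `χ = j` on the lens, which contains the zone
      have hlens : ‖ThickAlignment.inv (u : EuclideanSpace ℝ (Fin (n + 1))) y‖ ≤ r :=
        ThickAlignment.norm_inv_le_of_inner_ge hu1 h1 hm0 hr0.le (le_of_eq hrsq.symm)
          (by rw [real_inner_comm]; exact hym)
      have hχy : χ y = j y := hχ2 y hyu hlens h1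
      have hιO : ι y ∈ Λ '' O := hDΛO (mem_closedBall_zero_iff.2 (hιD y h1))
      simp only [hΨ]
      rw [hχy]; simp only [hj]
      rw [hright _ hιO, hιy]
    · -- outside: `χ = id`, `Λ = ι` on the shell over the cone
      push Not at h1
      have hχy : χ y = y := hχ1 y h1.le
      have hyO : y ∈ O := hshellO y (by rw [abs_of_nonneg (by linarith)]; linarith)
      have hcos' : m / 2 ≤ ⟪(u : EuclideanSpace ℝ (Fin (n + 1))), y⟫ / ‖y‖ := by
        rw [le_div_iff₀ (norm_pos_iff.2 hy0)]
        nlinarith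
      have := hΛι y hyO (by linarith) hy0 hcos'
      simp only [hΨ]
      rw [hχy, this, hιy]
  exact ⟨Ψ, Ψinv, δ', hδ'0, hδ'1, hΨs, hΨinj, hΨopen, hΨinvs, hΨleft, hΨright, hΨclosedBall,
    hΨsphere, hΨball, hagree⟩

end Literature.Topology.FourManifolds.AlignAssembly
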